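import Mathlib
import Literature.AlgebraicGeometry.Tropical.TorusCycles
import Summits.HodgeConjecture.HodgeConjecture.Theorems.TropicalWeilObstructionTropicalWeilVanishingFlatObstructionLinAlg
import HarnessLib

/-!
# Crux `TropicalWeilVanishing` (stmt-HodgeConjecture-18478), line `identity_transfer`:
# plane-pure incidence cycles obstruct — the flat rung without flatness

Route `TropicalWeilObstruction` of `HodgeConjecture`. The landed rung
`flatObstructed_of_weilFunctional_ne_zero` (file `…FlatObstructed`) shows that a FLAT effective tropical
`4`-cycle on `ℝ⁸/ℤ⁸` with `W ≠ 0` is obstructed at the identity. Its mechanism is local and needs neither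
flatness of the whole cycle nor `W ≠ 0` nor a totally real plane: it needs ONE plane-pure incidence cycle.

* `exists_obstruction_of_constraint_of_mem` — for ANY integer `2n × n` frame `L` (`n ≥ 2`) and any
  non-zero `κ ∈ M = L·ℝⁿ` there is a linear functional on `2n × 2n` matrices, non-zero at some symmetric
  `J`-commuting `D`, vanishing at every `Q'` with `Q' κ ∈ M`. (The rung's `exists_obstruction_of_constraint`
  assumed `η(L) ≠ 0`; here a dimension count replaces total reality: `{D κ : D ∈ Sym_J} ⊇ {|κ|² u + (u·κ) κ :
  u ⊥ J κ}` and `(Jκ)^⊥` has dimension `2n - 1 > n ≥ dim M`.)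
* `mulVec_cycleSum_mem_on` — Part B of the rung LOCALISED: real weights `y` on pairs of facet slots in a
  common class, forming a cycle, and such that the two cells of every pair have their frames in `M`, force
  `Q' · Σ_e y_e (k_{σ₁ e} - k_{σ₂ e}) ∈ M` on every realisation over `Q'` (no hypothesis on the other cells).
* `obstructed_of_planeIncidenceCycle` — **an effective tropical `4`-cycle `Z₀` on `ℝ⁸/ℤ⁸` carrying a
  plane-pure incidence cycle of non-zero total shift is `ObstructedAtIdentity`** (conclusion = the skeleton's
  `ObstructedAtIdentity Z₀` with `SameType` unfolded, exactly as in the rung). In particular every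
  facet-connected closed chain of cells parallel to one rational `4`-plane whose period shifts do not sum to
  zero obstructs (`obstructed_of_planeLoop`). This reduces the open stub `stub_nonflatObstructedAtIdentity`
  to types WITHOUT plane-pure incidence cycles of non-zero shift ("foams": every plane-pure facet-connected
  sub-collection develops into the universal cover without translation).

Mathlib + the sibling file `…FlatObstructionLinAlg` (for `weilJ` identities and the symmetric
`J`-commuting matrices `D(a,b)`); no definition, no named fact, no sorry.

## References

* [Zharkov2020TropicalWeil] I. Zharkov, Tropical abelian varieties, Weil classes and the Hodge
  conjecture, arXiv:2002.02347 (2020), §1–2 (pp. 2–4).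
* [MikhalkinZharkov2014Eigenwave] G. Mikhalkin, I. Zharkov, Tropical eigenwave and intermediate
  Jacobians, LN UMI 15 (2014), Def. 4.2, Prop. 4.3.
-/

-- `Summit.HodgeConjecture.HodgeConjecture.…` is the mandated namespace (single-conjunct summit).
set_option linter.dupNamespace false

noncomputable section

open scoped BigOperators Matrix
open Matrix Literature.AlgebraicGeometry.Tropical

namespace Summit.HodgeConjecture.HodgeConjecture.Theorems.TropicalWeilVanishing

/-! ## Part A′ — the obstruction functional without total reality -/

section LinAlg

variable {n : ℕ}

/-- **Obstruction from one type-forced lattice vector, any plane.** Let `L` be a `2n × n` integer matrix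
(`n ≥ 2`), `M = L·ℝⁿ`, and `κ ∈ M`, `κ ≠ 0`. Then some linear functional on real `2n × 2n` matrices is
non-zero at a symmetric matrix commuting with `J = weilJ n` and vanishes at every `Q'` with `Q' κ ∈ M`.
(Pick `u ⊥ Jκ` outside `M` — possible since `dim (Jκ)^⊥ = 2n - 1 > n ≥ dim M` — and
`D = κuᵀ + uκᵀ + (Jκ)(Ju)ᵀ + (Ju)(Jκ)ᵀ`: then `Dκ = (u·κ)κ + |κ|²u ∉ M`.)
[cite: Zharkov2020TropicalWeil, §1–2 (pp. 2–4)] -/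
theorem exists_obstruction_of_constraint_of_mem (hn : 2 ≤ n) (L : Matrix (Fin (2 * n)) (Fin n) ℤ)
    (κ : Fin (2 * n) → ℝ)
    (hκM : κ ∈ LinearMap.range (L.map ((↑) : ℤ → ℝ)).mulVecLin) (hκ : κ ≠ 0) :
    ∃ ℓ : Matrix (Fin (2 * n)) (Fin (2 * n)) ℝ →ₗ[ℝ] ℝ,
      (∃ D : Matrix (Fin (2 * n)) (Fin (2 * n)) ℝ, D.IsSymm ∧ D * weilJ n = weilJ n * D ∧ ℓ D ≠ 0) ∧
      ∀ Q' : Matrix (Fin (2 * n)) (Fin (2 * n)) ℝ,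
        Q' *ᵥ κ ∈ LinearMap.range (L.map ((↑) : ℤ → ℝ)).mulVecLin → ℓ Q' = 0 := by
  classical
  set Lr : Matrix (Fin (2 * n)) (Fin n) ℝ := L.map ((↑) : ℤ → ℝ) with hLr
  set M : Submodule ℝ (Fin (2 * n) → ℝ) := LinearMap.range Lr.mulVecLin with hM
  -- the functional `u ↦ (Jκ) · u` and its kernel `(Jκ)^⊥`
  let φ : (Fin (2 * n) → ℝ) →ₗ[ℝ] ℝ :=
    { toFun := fun u => (weilJ n *ᵥ κ) ⬝ᵥ u
      map_add' := fun u v => dotProduct_add _ _ _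
      map_smul' := fun c u => by rw [dotProduct_smul]; rfl }
  have hJκ : weilJ n *ᵥ κ ≠ 0 := by
    intro h
    apply hκ
    have := weilJ_mulVec_weilJ_mulVec (n := n) κ
    rw [h, Matrix.mulVec_zero] at this
    exact neg_eq_zero.mp this.symm
  have hφ : φ (weilJ n *ᵥ κ) ≠ 0 := by
    change (weilJ n *ᵥ κ) ⬝ᵥ (weilJ n *ᵥ κ) ≠ 0
    exact fun h => hJκ (dotProduct_self_eq_zero.mp h)
  -- dimension count: `ker φ` is not contained in `M`
  have hdimM : Module.finrank ℝ M ≤ n := by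
    have h1 := LinearMap.finrank_range_le (Lr.mulVecLin)
    simpa using h1
  have hker : ¬ (LinearMap.ker φ ≤ M) := by
    intro hle
    have h1 : Module.finrank ℝ (LinearMap.ker φ) ≤ Module.finrank ℝ M := Submodule.finrank_mono hle
    have h2 := LinearMap.finrank_range_add_finrank_ker φ
    have h3 : Module.finrank ℝ (LinearMap.range φ) ≤ 1 := by
      have := Submodule.finrank_le (LinearMap.range φ)
      simpa using this
    have h4 : Module.finrank ℝ (Fin (2 * n) → ℝ) = 2 * n := by simp
    rw [h4] at h2
    omega
  obtain ⟨u, huker, huM⟩ := SetLike.not_le_iff_exists.mp hker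
  have huJκ : (weilJ n *ᵥ κ) ⬝ᵥ u = 0 := huker
  -- the matrix `D = D(κ, u)`
  set D : Matrix (Fin (2 * n)) (Fin (2 * n)) ℝ :=
    vecMulVec κ u + vecMulVec u κ + vecMulVec (weilJ n *ᵥ κ) (weilJ n *ᵥ u) +
      vecMulVec (weilJ n *ᵥ u) (weilJ n *ᵥ κ) with hD
  have hDsymm : D.IsSymm := weilSymm_pair_transpose κ u
  have hDJ : D * weilJ n = weilJ n * D := weilSymm_pair_comm κ u
  have hJuκ : (weilJ n *ᵥ u) ⬝ᵥ κ = 0 := by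
    rw [weilJ_mulVec_dotProduct, dotProduct_comm, huJκ, neg_zero]
  have hJκκ : (weilJ n *ᵥ κ) ⬝ᵥ κ = 0 := by
    rw [weilJ_mulVec_dotProduct, dotProduct_weilJ_mulVec_self, neg_zero]
  have hDκ : D *ᵥ κ = (u ⬝ᵥ κ) • κ + (κ ⬝ᵥ κ) • u := by
    rw [hD, weilSymm_pair_mulVec, hJuκ, zero_smul, add_zero, hJκκ, zero_smul, add_zero]
  -- `D κ ∉ M`
  set A : Submodule ℝ (Matrix (Fin (2 * n)) (Fin (2 * n)) ℝ) :=
    M.comap ((LinearMap.applyₗ κ).comp (Matrix.toLin' (R := ℝ) (m := Fin (2 * n))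
      (n := Fin (2 * n))).toLinearMap) with hA
  have hAmem : ∀ Q' : Matrix (Fin (2 * n)) (Fin (2 * n)) ℝ, Q' ∈ A ↔ Q' *ᵥ κ ∈ M := by
    intro Q'
    simp [hA, Matrix.toLin'_apply]
  have hκκ : κ ⬝ᵥ κ ≠ 0 := fun h => hκ (dotProduct_self_eq_zero.mp h)
  have hDA : D ∉ A := by
    intro hDA'
    rw [hAmem, hDκ] at hDA'
    have h1 : (κ ⬝ᵥ κ) • u ∈ M := by
      have := M.sub_mem hDA' (M.smul_mem (u ⬝ᵥ κ) hκM)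
      rwa [add_sub_cancel_left] at this
    have h2 : u ∈ M := by
      have := M.smul_mem (κ ⬝ᵥ κ)⁻¹ h1
      rwa [smul_smul, inv_mul_cancel₀ hκκ, one_smul] at this
    exact huM h2
  obtain ⟨ℓ, hℓD, hℓA⟩ := Submodule.exists_dual_map_eq_bot_of_notMem hDA inferInstance
  refine ⟨ℓ, ⟨D, hDsymm, hDJ, hℓD⟩, fun Q' hQ' => ?_⟩
  have hQ'A : Q' ∈ A := (hAmem Q').2 hQ'
  have : ℓ Q' ∈ A.map ℓ := Submodule.mem_map_of_mem hQ'A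
  rw [hℓA] at this
  simpa using this

end LinAlg

/-! ## Part B, localised — plane-pure incidence cycles force `Q' κ ∈ M` -/

variable {g q : ℕ} {Q : Matrix (Fin g) (Fin g) ℝ}

/-- **One facet class, two `M`-parallel slots.** If the facet slots `(σ,i)` and `(τ,j)` lie in one class
and the frames of the two cells `σ`, `τ` have their columns in a subspace `M`, then
`v_{σ,0} - v_{τ,0} - Q (k_{σ,i} - k_{τ,j}) ∈ M`. (The rung's `vertex_sub_vertex_sub_mulVec_mem` with the
flatness hypothesis restricted to the two cells involved.) [cite: MikhalkinZharkov2014Eigenwave, Def. 4.2] -/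
theorem vertex_sub_vertex_sub_mulVec_mem_of_pair (Z : TropicalTorusCycle g (q + 1) Q)
    (M : Submodule ℝ (Fin g → ℝ)) {σ τ : Fin Z.numCells}
    (hσ : ∀ m : Fin (q + 1), (fun a => ((Z.cell σ).frame a m : ℝ)) ∈ M)
    (hτ : ∀ m : Fin (q + 1), (fun a => ((Z.cell τ).frame a m : ℝ)) ∈ M)
    {i j : Fin (q + 2)} (hcls : Z.facetClass σ i = Z.facetClass τ j) :
    (Z.cell σ).vertex 0 - (Z.cell τ).vertex 0 -
      Q *ᵥ ((fun a => (Z.facetShift σ i a : ℝ)) - fun a => (Z.facetShift τ j a : ℝ)) ∈ M := by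
  -- every vertex of an `M`-parallel cell is its vertex `0` plus a frame combination
  have hv : ∀ ρ : Fin Z.numCells, (∀ m : Fin (q + 1), (fun a => ((Z.cell ρ).frame a m : ℝ)) ∈ M) →
      ∀ k : Fin (q + 2), (Z.cell ρ).vertex k - (Z.cell ρ).vertex 0 ∈ M := by
    intro ρ hρ k
    refine Fin.cases ?_ (fun k' => ?_) k
    · simp
    · have : (Z.cell ρ).vertex k'.succ - (Z.cell ρ).vertex 0 =
          ∑ m, (Z.cell ρ).edgeCoeff m k' • fun a => ((Z.cell ρ).frame a m : ℝ) := by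
        ext a
        simp only [Pi.sub_apply, Finset.sum_apply, Pi.smul_apply, smul_eq_mul]
        rw [(Z.cell ρ).vertex_succ_sub k' a]
        exact Finset.sum_congr rfl fun m _ => mul_comm _ _
      rw [this]
      exact M.sum_mem fun m _ => M.smul_mem _ (hρ m)
  -- the chosen vertex of each facet is `R_f 0 + Q k`
  have hu : ∀ (ρ : Fin Z.numCells) (k : Fin (q + 2)),
      (Z.cell ρ).vertex (k.succAbove (Z.facetPerm ρ k 0)) =
        Z.refFacet (Z.facetClass ρ k) 0 + Q *ᵥ fun a => (Z.facetShift ρ k a : ℝ) := by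
    intro ρ k
    ext a
    rw [Pi.add_apply, Z.facet_eq ρ k 0 a]
    rfl
  have h1 := hv σ hσ (i.succAbove (Z.facetPerm σ i 0))
  have h2 := hv τ hτ (j.succAbove (Z.facetPerm τ j 0))
  rw [hu] at h1 h2
  rw [hcls] at h1
  have := M.sub_mem h2 h1
  rw [Matrix.mulVec_sub]
  convert this using 1
  abel

/-- **Plane-pure weighted incidence cycles.** Real weights `y` on pairs of facet slots in a common
class, forming a CYCLE (zero net weight at every cell) and such that BOTH cells of every pair have their
frames in the subspace `M`, satisfy `Q · Σ_e y_e (k_{σ₁ e} - k_{σ₂ e}) ∈ M` — whatever the other cells of the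
cycle do. [cite: MikhalkinZharkov2014Eigenwave, Def. 4.2] -/
theorem mulVec_cycleSum_mem_on (Z : TropicalTorusCycle g (q + 1) Q) (M : Submodule ℝ (Fin g → ℝ))
    {P : Type*} [Fintype P] (s₁ s₂ : P → Fin Z.numCells) (i₁ i₂ : P → Fin (q + 2))
    (hcls : ∀ e, Z.facetClass (s₁ e) (i₁ e) = Z.facetClass (s₂ e) (i₂ e))
    (hpar₁ : ∀ (e : P) (m : Fin (q + 1)), (fun a => ((Z.cell (s₁ e)).frame a m : ℝ)) ∈ M)
    (hpar₂ : ∀ (e : P) (m : Fin (q + 1)), (fun a => ((Z.cell (s₂ e)).frame a m : ℝ)) ∈ M)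
    (y : P → ℝ) (hcyc : ∀ φ : Fin Z.numCells → ℝ, ∑ e, y e * (φ (s₁ e) - φ (s₂ e)) = 0) :
    Q *ᵥ (∑ e, y e • ((fun a => (Z.facetShift (s₁ e) (i₁ e) a : ℝ)) -
      fun a => (Z.facetShift (s₂ e) (i₂ e) a : ℝ))) ∈ M := by
  have hsum : ∑ e, y e • ((Z.cell (s₁ e)).vertex 0 - (Z.cell (s₂ e)).vertex 0 -
      Q *ᵥ ((fun a => (Z.facetShift (s₁ e) (i₁ e) a : ℝ)) - fun a => (Z.facetShift (s₂ e) (i₂ e) a : ℝ))) ∈ M :=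
    M.sum_mem fun e _ => M.smul_mem _
      (vertex_sub_vertex_sub_mulVec_mem_of_pair Z M (hpar₁ e) (hpar₂ e) (hcls e))
  have hv0 : ∑ e, y e • ((Z.cell (s₁ e)).vertex 0 - (Z.cell (s₂ e)).vertex 0) = 0 := by
    ext a
    simp only [Finset.sum_apply, Pi.smul_apply, Pi.sub_apply, smul_eq_mul, Pi.zero_apply]
    exact hcyc fun ρ => (Z.cell ρ).vertex 0 a
  have hsplit : ∑ e, y e • ((Z.cell (s₁ e)).vertex 0 - (Z.cell (s₂ e)).vertex 0 -
      Q *ᵥ ((fun a => (Z.facetShift (s₁ e) (i₁ e) a : ℝ)) - fun a => (Z.facetShift (s₂ e) (i₂ e) a : ℝ))) =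
      ∑ e, y e • ((Z.cell (s₁ e)).vertex 0 - (Z.cell (s₂ e)).vertex 0) -
      ∑ e, y e • (Q *ᵥ ((fun a => (Z.facetShift (s₁ e) (i₁ e) a : ℝ)) -
        fun a => (Z.facetShift (s₂ e) (i₂ e) a : ℝ))) := by
    rw [← Finset.sum_sub_distrib]
    exact Finset.sum_congr rfl fun e _ => smul_sub _ _ _
  have hQ : ∑ e, y e • (Q *ᵥ ((fun a => (Z.facetShift (s₁ e) (i₁ e) a : ℝ)) -
        fun a => (Z.facetShift (s₂ e) (i₂ e) a : ℝ))) =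
      Q *ᵥ (∑ e, y e • ((fun a => (Z.facetShift (s₁ e) (i₁ e) a : ℝ)) -
        fun a => (Z.facetShift (s₂ e) (i₂ e) a : ℝ))) := by
    rw [Matrix.mulVec_sum]
    exact Finset.sum_congr rfl fun e _ => (Matrix.mulVec_smul _ _ _).symm
  rw [hsplit, hv0, zero_sub, hQ] at hsum
  exact (M.neg_mem_iff).1 hsum

/-! ## Assembly — plane-pure incidence cycles of non-zero shift obstruct at the identity -/

/-- **An effective tropical `4`-cycle on `ℝ⁸/ℤ⁸` carrying a plane-pure incidence cycle of non-zero
total shift is obstructed at the identity.** Data: an integer `8 × 4` matrix `L` (the plane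
`M = L·ℝ⁴`), finitely many pairs `e` of facet slots `(σ₁ e, i₁ e)`, `(σ₂ e, i₂ e)` in a common class whose
two cells have frames with columns in `M`, and real weights `y` with zero net weight at every cell and
`κ = Σ_e y_e (k_{σ₁ e} - k_{σ₂ e}) ≠ 0`. Conclusion: `ObstructedAtIdentity Z₀` of
`Cruxes/TropicalWeilVanishing/Lines/identity_transfer.lean` with `SameType` unfolded (verbatim as in the
rung `flatObstructed_of_weilFunctional_ne_zero`). Proof: `κ ∈ M` from `Z₀` itself (`Q' = 1`), `Q' κ ∈ M`
on every realisation of the type over `Q'` (same frames, classes, shifts), and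
`exists_obstruction_of_constraint_of_mem`. No flatness of `Z₀`, no `W ≠ 0`, no total reality needed.
[cite: Zharkov2020TropicalWeil, §1–2 (pp. 2–4)] [cite: MikhalkinZharkov2014Eigenwave, Def. 4.2 and Prop. 4.3] -/
theorem obstructed_of_planeIncidenceCycle
    (Z₀ : TropicalTorusCycle (2 * 4) 4 (1 : Matrix (Fin (2 * 4)) (Fin (2 * 4)) ℝ))
    (L : Matrix (Fin (2 * 4)) (Fin 4) ℤ)
    {P : Type*} [Fintype P] (s₁ s₂ : P → Fin Z₀.numCells) (i₁ i₂ : P → Fin (3 + 2))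
    (hcls : ∀ e, Z₀.facetClass (s₁ e) (i₁ e) = Z₀.facetClass (s₂ e) (i₂ e))
    (hpar₁ : ∀ (e : P) (m : Fin 4), ∃ c : Fin 4 → ℝ,
      ∀ a : Fin (2 * 4), ((Z₀.cell (s₁ e)).frame a m : ℝ) = ∑ m' : Fin 4, (L a m' : ℝ) * c m')
    (hpar₂ : ∀ (e : P) (m : Fin 4), ∃ c : Fin 4 → ℝ,
      ∀ a : Fin (2 * 4), ((Z₀.cell (s₂ e)).frame a m : ℝ) = ∑ m' : Fin 4, (L a m' : ℝ) * c m')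
    (y : P → ℝ) (hcyc : ∀ φ : Fin Z₀.numCells → ℝ, ∑ e, y e * (φ (s₁ e) - φ (s₂ e)) = 0)
    (hκ : ∑ e, y e • ((fun a => (Z₀.facetShift (s₁ e) (i₁ e) a : ℝ)) -
      fun a => (Z₀.facetShift (s₂ e) (i₂ e) a : ℝ)) ≠ 0) :
    ∃ ℓ : Matrix (Fin (2 * 4)) (Fin (2 * 4)) ℝ →ₗ[ℝ] ℝ,
      (∃ D : Matrix (Fin (2 * 4)) (Fin (2 * 4)) ℝ, D.IsSymm ∧
        D * weilJ 4 = weilJ 4 * D ∧ ℓ D ≠ 0) ∧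
      ∀ Q' : Matrix (Fin (2 * 4)) (Fin (2 * 4)) ℝ, Q'.IsSymm → Q' * weilJ 4 = weilJ 4 * Q' →
        (∃ Z' : TropicalTorusCycle (2 * 4) 4 Q',
          ∃ (hc : Z'.numCells = Z₀.numCells) (hf : Z'.numFacetClasses = Z₀.numFacetClasses),
            ∀ σ : Fin Z'.numCells,
              (Z'.cell σ).weight = (Z₀.cell (Fin.cast hc σ)).weight ∧
              (Z'.cell σ).frame = (Z₀.cell (Fin.cast hc σ)).frame ∧
              ∀ i : Fin (4 + 1),
                Fin.cast hf (Z'.facetClass σ i) = Z₀.facetClass (Fin.cast hc σ) i ∧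
                Z'.facetPerm σ i = Z₀.facetPerm (Fin.cast hc σ) i ∧
                Z'.facetShift σ i = Z₀.facetShift (Fin.cast hc σ) i) → ℓ Q' = 0 := by
  classical
  set M : Submodule ℝ (Fin (2 * 4) → ℝ) := LinearMap.range (L.map ((↑) : ℤ → ℝ)).mulVecLin with hM
  -- membership in `M` from the coefficient description
  have hmemM : ∀ v : Fin (2 * 4) → ℝ, (∃ c : Fin 4 → ℝ, ∀ a, v a = ∑ m' : Fin 4, (L a m' : ℝ) * c m') → v ∈ M := by
    rintro v ⟨c, hc⟩
    refine ⟨c, ?_⟩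
    ext a
    simp only [Matrix.mulVecLin_apply, Matrix.mulVec, dotProduct, Matrix.map_apply]
    rw [hc a]
  have hM₁ : ∀ (e : P) (m : Fin 4), (fun a => ((Z₀.cell (s₁ e)).frame a m : ℝ)) ∈ M :=
    fun e m => hmemM _ (hpar₁ e m)
  have hM₂ : ∀ (e : P) (m : Fin 4), (fun a => ((Z₀.cell (s₂ e)).frame a m : ℝ)) ∈ M :=
    fun e m => hmemM _ (hpar₂ e m)
  -- `κ ∈ M`: `Z₀` realises its own type at `Q' = 1`
  have hκM := mulVec_cycleSum_mem_on Z₀ M s₁ s₂ i₁ i₂ hcls hM₁ hM₂ y hcyc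
  rw [Matrix.one_mulVec] at hκM
  -- the obstruction functional
  obtain ⟨ℓ, hD, hvan⟩ := exists_obstruction_of_constraint_of_mem (n := 4) (by norm_num) L _ hκM hκ
  refine ⟨ℓ, hD, fun Q' _ _ hZ' => hvan Q' ?_⟩
  obtain ⟨Z', hc, hf, hZ'⟩ := hZ'
  -- `Z'` carries the same plane-pure incidence cycle, so `Q' κ ∈ M`
  have hcast : ∀ σ : Fin Z₀.numCells, Fin.cast hc (Fin.cast hc.symm σ) = σ := fun σ => Fin.ext rfl
  have hM₁' : ∀ (e : P) (m : Fin 4), (fun a => ((Z'.cell (Fin.cast hc.symm (s₁ e))).frame a m : ℝ)) ∈ M := by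
    intro e m
    rw [(hZ' _).2.1, hcast]
    exact hM₁ e m
  have hM₂' : ∀ (e : P) (m : Fin 4), (fun a => ((Z'.cell (Fin.cast hc.symm (s₂ e))).frame a m : ℝ)) ∈ M := by
    intro e m
    rw [(hZ' _).2.1, hcast]
    exact hM₂ e m
  have hcls' : ∀ e : P,
      Z'.facetClass (Fin.cast hc.symm (s₁ e)) (i₁ e) = Z'.facetClass (Fin.cast hc.symm (s₂ e)) (i₂ e) := by
    intro e
    apply Fin.cast_injective hf
    rw [((hZ' _).2.2 _).1, ((hZ' _).2.2 _).1, hcast, hcast]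
    exact hcls e
  have hcyc' : ∀ φ : Fin Z'.numCells → ℝ,
      ∑ e, y e * (φ (Fin.cast hc.symm (s₁ e)) - φ (Fin.cast hc.symm (s₂ e))) = 0 :=
    fun φ => hcyc fun σ => φ (Fin.cast hc.symm σ)
  have key := mulVec_cycleSum_mem_on Z' M (fun e => Fin.cast hc.symm (s₁ e)) (fun e => Fin.cast hc.symm (s₂ e))
    i₁ i₂ hcls' hM₁' hM₂' y hcyc'
  have hshift : ∀ e : P,
      ((fun a => (Z'.facetShift (Fin.cast hc.symm (s₁ e)) (i₁ e) a : ℝ)) -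
        fun a => (Z'.facetShift (Fin.cast hc.symm (s₂ e)) (i₂ e) a : ℝ)) =
      ((fun a => (Z₀.facetShift (s₁ e) (i₁ e) a : ℝ)) -
        fun a => (Z₀.facetShift (s₂ e) (i₂ e) a : ℝ)) := by
    intro e
    rw [((hZ' _).2.2 _).2.2, ((hZ' _).2.2 _).2.2, hcast, hcast]
  simp only [hshift] at key
  exact key

/-- **Plane-pure closed chains of cells obstruct.** A closed chain `σ₀, σ₁, …, σ_m, σ_{m+1} = σ₀` of cells of
an effective tropical `4`-cycle `Z₀` on `ℝ⁸/ℤ⁸`, all with frames in one rational `4`-plane `M = L·ℝ⁴`,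
consecutive cells glued along a common facet class (slot `i t` of `σ t` with slot `j (t+1)` of `σ (t+1)`),
whose period shifts do not cancel (`Σ_t (k_{σ t, i t} - k_{σ (t+1), j (t+1)}) ≠ 0`), makes `Z₀` obstructed at
the identity. (The incidence cycle with all weights `1` on the chain.) Every facet-connected component of
`M`-parallel cells that closes up around the torus with non-zero translation is such a chain; so the open
stub `stub_nonflatObstructedAtIdentity` is reduced to types all of whose plane-pure facet-connected pieces
develop into the universal cover without translation.
[cite: Zharkov2020TropicalWeil, §1–2 (pp. 2–4)] [cite: MikhalkinZharkov2014Eigenwave, Def. 4.2 and Prop. 4.3] -/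
theorem obstructed_of_planeLoop
    (Z₀ : TropicalTorusCycle (2 * 4) 4 (1 : Matrix (Fin (2 * 4)) (Fin (2 * 4)) ℝ))
    (L : Matrix (Fin (2 * 4)) (Fin 4) ℤ) {m : ℕ}
    (σ : Fin (m + 1) → Fin Z₀.numCells) (i j : Fin (m + 1) → Fin (3 + 2))
    (hcls : ∀ t, Z₀.facetClass (σ t) (i t) = Z₀.facetClass (σ (finRotate (m + 1) t)) (j (finRotate (m + 1) t)))
    (hpar : ∀ (t : Fin (m + 1)) (m' : Fin 4), ∃ c : Fin 4 → ℝ,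
      ∀ a : Fin (2 * 4), ((Z₀.cell (σ t)).frame a m' : ℝ) = ∑ m'' : Fin 4, (L a m'' : ℝ) * c m'')
    (hκ : ∑ t, ((fun a => (Z₀.facetShift (σ t) (i t) a : ℝ)) -
      fun a => (Z₀.facetShift (σ (finRotate (m + 1) t)) (j (finRotate (m + 1) t)) a : ℝ)) ≠ 0) :
    ∃ ℓ : Matrix (Fin (2 * 4)) (Fin (2 * 4)) ℝ →ₗ[ℝ] ℝ,
      (∃ D : Matrix (Fin (2 * 4)) (Fin (2 * 4)) ℝ, D.IsSymm ∧
        D * weilJ 4 = weilJ 4 * D ∧ ℓ D ≠ 0) ∧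
      ∀ Q' : Matrix (Fin (2 * 4)) (Fin (2 * 4)) ℝ, Q'.IsSymm → Q' * weilJ 4 = weilJ 4 * Q' →
        (∃ Z' : TropicalTorusCycle (2 * 4) 4 Q',
          ∃ (hc : Z'.numCells = Z₀.numCells) (hf : Z'.numFacetClasses = Z₀.numFacetClasses),
            ∀ σ : Fin Z'.numCells,
              (Z'.cell σ).weight = (Z₀.cell (Fin.cast hc σ)).weight ∧
              (Z'.cell σ).frame = (Z₀.cell (Fin.cast hc σ)).frame ∧
              ∀ i : Fin (4 + 1),
                Fin.cast hf (Z'.facetClass σ i) = Z₀.facetClass (Fin.cast hc σ) i ∧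
                Z'.facetPerm σ i = Z₀.facetPerm (Fin.cast hc σ) i ∧
                Z'.facetShift σ i = Z₀.facetShift (Fin.cast hc σ) i) → ℓ Q' = 0 := by
  refine obstructed_of_planeIncidenceCycle Z₀ L σ (fun t => σ (finRotate (m + 1) t)) i
    (fun t => j (finRotate (m + 1) t)) hcls hpar (fun t m' => hpar _ m') (fun _ => 1) (fun φ => ?_) ?_
  · simp only [one_mul, Finset.sum_sub_distrib]
    rw [Equiv.sum_comp (finRotate (m + 1)) (fun t => φ (σ t))]
    exact sub_self _
  · simpa only [one_smul] using hκ

end Summit.HodgeConjecture.HodgeConjecture.Theorems.TropicalWeilVanishing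

end
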